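import Mathlib

/-!
# SoloBlind — one step of the continued-fraction tail under a diagonal shift (ENGINE L fold row, PLAN §125.2, F-g101-2)

The folded chain matrices of ENGINE L carry on their last row the continued-fraction tail
`t_k(μ) = a_k / (β_k + μ - c_k t_{k+1}(μ))`, which moves with the shift `μ` of the cell.  The engine bounds
its Lipschitz constant by the backward recursion `D_k = (τ_k'^2 / a_k) (1 + c_k D_{k+1})`,
`τ_k' = 1 / (1/τ_k - (s/a_k)(1 + c_k D_{k+1}))` (engine v1.2j `tail_lip_rec`).  This file proves the STEP of
that recursion as a statement about one Möbius map: from a supremum/Lipschitz bound of the deeper tail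
`u = t_{k+1}` on the shift disc `‖μ‖ ≤ s` and the centre value `‖β - c u 0‖ ≥ a/τ`, the map
`t μ = a / (β + μ - c u μ)` is well defined on the disc, bounded by `a/δ` and `(a/δ^2)(1 + c D)`-Lipschitz,
`δ = a/τ - s (1 + c D) > 0` (`tail_step_den`, `tail_step_bound`, `tail_step_lip`); `fold_entry_le` is the
resulting bound `‖μ - c_J (t μ - t 0)‖ ≤ s (1 + c_J D_t)` on the fold-row entry of the diagonal perturbation
fed to `SoloBlindGainEntrywise`.  The seed of the recursion (the infinite tail at the Pringsheim depth) is
the engine's tail ball and belongs to the owed item J-TAIL.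
-/

namespace Summit.AnomalousDissipation.SoloBlind.TailLipschitz

variable {a c s τ D : ℝ} {β : ℂ} {u : ℂ → ℂ}

/-- The denominator of one continued-fraction step under the shift `μ`. -/
def den (c : ℝ) (β : ℂ) (u : ℂ → ℂ) (μ : ℂ) : ℂ := β + μ - (c : ℂ) * u μ

/-- Lower bound of the shifted denominator on the disc `‖μ‖ ≤ s`:
`‖den μ‖ ≥ a/τ - s(1 + c D)` when `‖den 0‖ ≥ a/τ` and `u` is `D`-Lipschitz from the centre. -/
theorem tail_step_den (hc : 0 ≤ c) (h0 : a / τ ≤ ‖den c β u 0‖)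
    (hu : ∀ μ : ℂ, ‖μ‖ ≤ s → ‖u μ - u 0‖ ≤ D * ‖μ‖) {μ : ℂ} (hμ : ‖μ‖ ≤ s) (hD : 0 ≤ D) :
    a / τ - s * (1 + c * D) ≤ ‖den c β u μ‖ := by
  have h1 : den c β u μ = den c β u 0 + (μ - (c : ℂ) * (u μ - u 0)) := by
    simp only [den]; ring
  have h2 : ‖μ - (c : ℂ) * (u μ - u 0)‖ ≤ s * (1 + c * D) := by
    calc ‖μ - (c : ℂ) * (u μ - u 0)‖ ≤ ‖μ‖ + ‖(c : ℂ) * (u μ - u 0)‖ := norm_sub_le _ _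
      _ = ‖μ‖ + c * ‖u μ - u 0‖ := by rw [norm_mul, Complex.norm_real, Real.norm_of_nonneg hc]
      _ ≤ s + c * (D * s) := add_le_add hμ (mul_le_mul_of_nonneg_left
          ((hu μ hμ).trans (mul_le_mul_of_nonneg_left hμ hD)) hc)
      _ = s * (1 + c * D) := by ring
  have h3 : ‖den c β u 0‖ - ‖μ - (c : ℂ) * (u μ - u 0)‖ ≤ ‖den c β u μ‖ := by
    rw [h1]
    have h4 : ‖den c β u 0‖ ≤ ‖den c β u 0 + (μ - (c : ℂ) * (u μ - u 0))‖ + ‖μ - (c : ℂ) * (u μ - u 0)‖ := by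
      have := norm_sub_le (den c β u 0 + (μ - (c : ℂ) * (u μ - u 0))) (μ - (c : ℂ) * (u μ - u 0))
      simpa only [add_sub_cancel_right] using this
    linarith
  linarith

/-- Supremum bound of the step: `‖a / den μ‖ ≤ a/δ` on the disc, `δ = a/τ - s(1 + cD) > 0`. -/
theorem tail_step_bound (ha : 0 ≤ a) (hc : 0 ≤ c) (h0 : a / τ ≤ ‖den c β u 0‖)
    (hu : ∀ μ : ℂ, ‖μ‖ ≤ s → ‖u μ - u 0‖ ≤ D * ‖μ‖) (hD : 0 ≤ D)
    (hδ : 0 < a / τ - s * (1 + c * D)) {μ : ℂ} (hμ : ‖μ‖ ≤ s) :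
    den c β u μ ≠ 0 ∧ ‖(a : ℂ) / den c β u μ‖ ≤ a / (a / τ - s * (1 + c * D)) := by
  have hden := tail_step_den hc h0 hu hμ hD
  have hpos : 0 < ‖den c β u μ‖ := lt_of_lt_of_le hδ hden
  refine ⟨norm_pos_iff.mp hpos, ?_⟩
  rw [norm_div, Complex.norm_real, Real.norm_of_nonneg ha]
  exact div_le_div_of_nonneg_left ha hδ hden

/-- Lipschitz bound of the step: for `μ, μ'` in the disc,
`‖a/den μ - a/den μ'‖ ≤ (a/δ^2)(1 + c D') ‖μ - μ'‖` where `D'` is a Lipschitz constant of `u` on the disc. -/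
theorem tail_step_lip (ha : 0 ≤ a) (hc : 0 ≤ c) (h0 : a / τ ≤ ‖den c β u 0‖)
    (hu : ∀ μ : ℂ, ‖μ‖ ≤ s → ‖u μ - u 0‖ ≤ D * ‖μ‖) (hD : 0 ≤ D)
    (hδ : 0 < a / τ - s * (1 + c * D)) {D' : ℝ}
    (hu' : ∀ μ μ' : ℂ, ‖μ‖ ≤ s → ‖μ'‖ ≤ s → ‖u μ - u μ'‖ ≤ D' * ‖μ - μ'‖)
    {μ μ' : ℂ} (hμ : ‖μ‖ ≤ s) (hμ' : ‖μ'‖ ≤ s) :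
    ‖(a : ℂ) / den c β u μ - (a : ℂ) / den c β u μ'‖ ≤
      a / (a / τ - s * (1 + c * D)) ^ 2 * (1 + c * D') * ‖μ - μ'‖ := by
  set δ := a / τ - s * (1 + c * D) with hδ_def
  have hd := tail_step_den hc h0 hu hμ hD
  have hd' := tail_step_den hc h0 hu hμ' hD
  have hp : 0 < ‖den c β u μ‖ := lt_of_lt_of_le hδ hd
  have hp' : 0 < ‖den c β u μ'‖ := lt_of_lt_of_le hδ hd'
  have hne : den c β u μ ≠ 0 := norm_pos_iff.mp hp
  have hne' : den c β u μ' ≠ 0 := norm_pos_iff.mp hp'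
  have hdiff : (a : ℂ) / den c β u μ - (a : ℂ) / den c β u μ' =
      (a : ℂ) * (den c β u μ' - den c β u μ) / (den c β u μ * den c β u μ') := by
    rw [div_sub_div _ _ hne hne']
    ring
  have hdd : ‖den c β u μ' - den c β u μ‖ ≤ (1 + c * D') * ‖μ - μ'‖ := by
    have h1 : den c β u μ' - den c β u μ = (μ' - μ) - (c : ℂ) * (u μ' - u μ) := by
      simp only [den]; ring
    rw [h1]
    calc ‖μ' - μ - (c : ℂ) * (u μ' - u μ)‖ ≤ ‖μ' - μ‖ + ‖(c : ℂ) * (u μ' - u μ)‖ := norm_sub_le _ _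
      _ = ‖μ - μ'‖ + c * ‖u μ' - u μ‖ := by
          rw [norm_mul, Complex.norm_real, Real.norm_of_nonneg hc, norm_sub_rev]
      _ ≤ ‖μ - μ'‖ + c * (D' * ‖μ' - μ‖) :=
          add_le_add le_rfl (mul_le_mul_of_nonneg_left (hu' μ' μ hμ' hμ) hc)
      _ = (1 + c * D') * ‖μ - μ'‖ := by rw [norm_sub_rev μ' μ]; ring
  rw [hdiff, norm_div, norm_mul, norm_mul, Complex.norm_real, Real.norm_of_nonneg ha]
  have hD'0 : 0 ≤ (1 + c * D') * ‖μ - μ'‖ := le_trans (norm_nonneg _) hdd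
  have hprod : δ ^ 2 ≤ ‖den c β u μ‖ * ‖den c β u μ'‖ := by
    rw [sq]; exact mul_le_mul hd hd' hδ.le (le_of_lt hp)
  have hδ2 : 0 < δ ^ 2 := by positivity
  calc a * ‖den c β u μ' - den c β u μ‖ / (‖den c β u μ‖ * ‖den c β u μ'‖)
      ≤ a * ((1 + c * D') * ‖μ - μ'‖) / (‖den c β u μ‖ * ‖den c β u μ'‖) :=
        div_le_div_of_nonneg_right (mul_le_mul_of_nonneg_left hdd ha) (mul_pos hp hp').le
    _ ≤ a * ((1 + c * D') * ‖μ - μ'‖) / δ ^ 2 :=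
        div_le_div_of_nonneg_left (mul_nonneg ha hD'0) hδ2 hprod
    _ = a / δ ^ 2 * (1 + c * D') * ‖μ - μ'‖ := by ring

/-- The fold-row entry of the diagonal perturbation: if the tail `t` is `Dt`-Lipschitz from the centre on the
disc then `‖μ - c_J (t μ - t 0)‖ ≤ s (1 + c_J Dt)` for `‖μ‖ ≤ s`. -/
theorem fold_entry_le {cJ Dt : ℝ} {t : ℂ → ℂ} (hc : 0 ≤ cJ) (hDt : 0 ≤ Dt)
    (ht : ∀ μ : ℂ, ‖μ‖ ≤ s → ‖t μ - t 0‖ ≤ Dt * ‖μ‖) {μ : ℂ} (hμ : ‖μ‖ ≤ s) :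
    ‖μ - (cJ : ℂ) * (t μ - t 0)‖ ≤ s * (1 + cJ * Dt) := by
  calc ‖μ - (cJ : ℂ) * (t μ - t 0)‖ ≤ ‖μ‖ + ‖(cJ : ℂ) * (t μ - t 0)‖ := norm_sub_le _ _
    _ = ‖μ‖ + cJ * ‖t μ - t 0‖ := by rw [norm_mul, Complex.norm_real, Real.norm_of_nonneg hc]
    _ ≤ s + cJ * (Dt * s) :=
        add_le_add hμ (mul_le_mul_of_nonneg_left ((ht μ hμ).trans (mul_le_mul_of_nonneg_left hμ hDt)) hc)
    _ = s * (1 + cJ * Dt) := by ring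

end Summit.AnomalousDissipation.SoloBlind.TailLipschitz
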